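import Summits.CriticalPhenomena.CardyFormulaZ2.Theses.CardyTensorRG

/-!
# Birth skeleton (BC3) for crux `PolyominoToJordan` (stmt-CriticalPhenomena-14338)

Route `CardyTensorRG` of `CardyFormulaZ2`, crux r9 (the route's easiest, "known technology"):

  `PolyominoToJordan := ∀ F continuous on (0,1), (every POLYOMINO conformal rectangle — interior of
  a finite union of closed δ₀-squares, marks at δ₀-lattice points — has bond-ℤ² crossing limit
  F(cross-ratio)) → every conformal rectangle has bond-ℤ² crossing limit F(cross-ratio)`.

## The line (two-sided polyomino sandwich with modulus control; `F` enters only in the assembly)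

Fix `R = (Ω; a, b, c, d)` with uniformizing datum `(φ, x)`, `η = crossRatio x ∈ (0,1)`, `ε > 0`.

* `stub_lowerPolyominoSandwich` (F-free; M given the tree): a POLYOMINO conformal rectangle `P`
  (lattice marks) carrying a uniformizing datum of cross-ratio within `ε` of `η`, which is crossed
  AT MOST `ε` more often than `R` for all small meshes: `bond P δ ≤ bond R δ + ε` eventually as
  `δ → 0⁺`.  Intended proof = the LOWER half of the tree's construction-free Bollobás–Riordan
  sandwich, verbatim the `hlow` block of `LatticePolygonApproximation.cardyFormulaZ2_of_cardyLatticePolygon`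
  (`Theorems/CardyPolygonWordsAssembly.lean`, PROVED for F = cardyFunction): lower comparison quad
  `Q` (`stub_comparisonGeometry`, proved), lattice-polygon approximant `exists_latticePolygon_close`
  (proved; its output `⟨d, hd, hPcell, hPpt⟩` IS the polyomino predicate of this crux), re-marking
  with room `r/2`, deterministic inclusion `discreteCrossing_subset_of_lower` (slack 0), and the
  modulus clause from `stub_cardyContinuity`'s F-free core = Radó
  (`ConformalRectangle.tendsto_crossRatio_of_tendsto_mark`, or the ε-form
  `CollarTouchSandwich.stub_modulusContinuity` with shift `c = 0`, both PROVED).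
* `stub_upperPolyominoSandwich` (F-free; M–L, the NEW part): the same from ABOVE, `bond R δ ≤
  bond P δ + ε` eventually, `P` polyomino with cross-ratio within `ε` of `η`.  The tree's two
  landed Jordan-extension proofs (PolygonReduction 4784, RectilinearSuffices 5663) do NOT contain
  this: they obtain the upper bound from the LOWER one for the cyclically re-marked quad `R₂` plus
  the symmetry `cardyFunction (1 - η) = 1 - cardyFunction η` (`stub_cyclicFlip`), which a general
  continuous `F` does not offer (this is exactly the crux's "why it might fail": no boundary-value /
  symmetry shortcut).  Intended flip-free proof: square model `Φ` of `R` respecting the corners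
  (`exists_isSquareModel_pt`, `hasCrossingLimit_iff_map_unitSquareQuad` — same carrier, arcs and
  marked points, hence the same crossing EVENTS and the same cross-ratio), the wider–shorter
  perturbation `D⁺ = perturbQuad Φ (-1-t) (1+t) (-1+τ) (1-τ)` in MIXED POSITION above the quad
  (`exists_upper_sandwich`, `exists_forall_discreteCrossing_subset_of_mixed`: DETERMINISTIC
  inclusion of G02 crossing events for all small meshes, no corner arm events; all PROVED in
  `Theorems/CardyBoundaryCoulombGasRectilinearSuffices{SquareModel,UpperSandwich,Mixed}.lean`), a
  lattice-polygon approximant of `D⁺` (`exists_latticePolygon_close`) with its marks matched to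
  `quarterMarks` (re-marking with room as in the PolygonWords assembly, or `exists_reparam`), and
  the modulus clause by Radó as `t, τ → 0` (loops `Φ ∘ ∂[rectangle]` converge uniformly by uniform
  continuity of `Φ`; cross-ratio is presentation-independent, `crossRatio_eq_of_isUniformizing_holds`).
  Alternative proof (Bollobás–Riordan collars + four corner one-arm events,
  `annulusOpenCrossing_half_le_holds`) gives the inequality with slack `ε` instead of an inclusion —
  the statement is typed to admit either.
* `PolyominoToJordan_of` (kernel-checked, no `sorry`): continuity of `F` at `η ∈ (0,1)`
  (`crossRatio_mem_Ioo_of_isUniformizing`) turns the modulus clauses into `|F(η_P) - F(η)| < e/3`,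
  the hypothesis on the polyomino `P` gives `bond P δ → F(η_P)`, and the two one-sided comparisons
  squeeze `bond R δ` into `(F(η) - e, F(η) + e)` eventually; `Metric.tendsto_nhds`.

Hardest stub: `stub_upperPolyominoSandwich` (mark matching + presentation transfer are unwritten;
everything else is a landed lemma).  Neither stub mentions `F`, `HasCrossingLimit` or Cardy's
function, so neither is the crux or the summit in costume (BC3 probes below).

## Disproof used / negatives
No `Cruxes/PolyominoToJordan/Disproof.lean` exists (no cdisprove seat has run on this crux; `ledger
crux ls` shows no workfiles before this one), so there is no `_false_without_` obstruction to honour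
and no landed `Negative/` lemma to import.  `ledger negatives --problem CriticalPhenomena` (11
entries, 2026-08-17): none is an instance of a stub; the only crossing-probability entry,
`NegDegenerateArcs` stmt-0748 (`¬ ∃ R, ∃ᶠ δ, bondDomainCrossingProb R δ = 0`, refuted), supports
non-degeneracy and is consistent with both sandwiches.  Refuter evidence on the item (rattack-14338,
Evidence.lean/ATTACK.md; grounder g39-20) sketches the same two-sided approximation line.

## Check and BC3 probes (planner folder `bc/`; raw outputs in the planner's NOTES.md)
`lean check --json bc/PolyominoToJordan_birth.lean`: rc 0, errors [], sorries 2 = the two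
`stub_*` (warnings `declaration uses sorry` at the two stubs only); `#print axioms
PolyominoToJordan_of` = [propext, Classical.choice, Quot.sound] (no sorryAx); audit target of
`PolyominoToJordan_of` = `Summit.CriticalPhenomena.CardyFormulaZ2.Theses.CardyTensorRG.PolyominoToJordan`.
Probes `bc/PolyominoToJordan_probe.lean` (stub statements pasted literally; `set_option
maxHeartbeats 400000 in example : S → T := by first | exact? | simpa | simpa [PolyominoToJordan,
Literature.Probability.Percolation.CardyFormulaZ2] | aesop`): for `S ∈ {stub_lower…, stub_upper…}`
and `T ∈ {PolyominoToJordan, CardyFormulaZ2}` all FOUR FAIL — rc 1, four `unsolved goals ⊢ T`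
errors (lines 34, 62, 90, 118), `aesop: failed to prove the goal after exhaustive search` ×4,
wall 127 s.  No stub is cheaply the crux or the summit.
-/

noncomputable section

open Set Filter Topology Metric
open UpperHalfPlane (upperHalfPlaneSet)
open Literature.Probability.RandomPlanarGeometry
open Literature.Probability.Percolation (bondDomainCrossingProb)

namespace Summit.CriticalPhenomena.CardyFormulaZ2.Cruxes.PolyominoToJordan.Birth

/-! ### The two statements of the line

Each statement is a precise `Prop` (`LowerPolyominoSandwich`, `UpperPolyominoSandwich`), restated
VERBATIM by its registered `theorem stub_… := by sorry` below (the only `sorry`s of the file) and aliased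
under the stub's short name in the implementation-detail namespace `__Registered` (the hypotheses of
`PolyominoToJordan_of`, admissible BY NAME for the native skeleton audit — device of
`Cruxes/LoopsToCrossings/Lines/br-sandwich-diagonal.lean`); `polyominoToJordan_of_stubs` applies the
composition to the two `stub_…` literally, which checks that statements, aliases and stubs agree. -/

/-- STATEMENT 1 — lower polyomino sandwich with modulus control (see `stub_lowerPolyominoSandwich`). -/
def LowerPolyominoSandwich : Prop :=
    ∀ (R : Literature.Probability.RandomPlanarGeometry.ConformalRectangle)
      (φ : Literature.Probability.RandomPlanarGeometry.ConformalEquiv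
        UpperHalfPlane.upperHalfPlaneSet R.carrier)
      (x : Fin 4 → ℝ), R.IsUniformizing φ x → ∀ ε : ℝ, 0 < ε →
      ∃ P : Literature.Probability.RandomPlanarGeometry.ConformalRectangle,
        (∃ δ₀ : ℝ, 0 < δ₀ ∧ (∃ s : Finset (ℤ × ℤ), P.carrier = interior (⋃ p ∈ s,
          {z : ℂ | δ₀ * (p.1 : ℝ) ≤ z.re ∧ z.re ≤ δ₀ * ((p.1 : ℝ) + 1) ∧ δ₀ * (p.2 : ℝ) ≤ z.im ∧
            z.im ≤ δ₀ * ((p.2 : ℝ) + 1)})) ∧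
          ∀ i, ∃ m n : ℤ, P.pt i = (δ₀ : ℂ) * ((m : ℂ) + (n : ℂ) * Complex.I)) ∧
        (∃ (ψ : Literature.Probability.RandomPlanarGeometry.ConformalEquiv
            UpperHalfPlane.upperHalfPlaneSet P.carrier) (y : Fin 4 → ℝ),
          P.IsUniformizing ψ y ∧
            |Literature.Probability.RandomPlanarGeometry.crossRatio y -
              Literature.Probability.RandomPlanarGeometry.crossRatio x| ≤ ε) ∧
        ∀ᶠ δ : ℝ in nhdsWithin 0 (Set.Ioi 0),
          Literature.Probability.Percolation.bondDomainCrossingProb P δ ≤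
            Literature.Probability.Percolation.bondDomainCrossingProb R δ + ε

/-- STATEMENT 2 — upper polyomino sandwich with modulus control (see `stub_upperPolyominoSandwich`). -/
def UpperPolyominoSandwich : Prop :=
    ∀ (R : Literature.Probability.RandomPlanarGeometry.ConformalRectangle)
      (φ : Literature.Probability.RandomPlanarGeometry.ConformalEquiv
        UpperHalfPlane.upperHalfPlaneSet R.carrier)
      (x : Fin 4 → ℝ), R.IsUniformizing φ x → ∀ ε : ℝ, 0 < ε →
      ∃ P : Literature.Probability.RandomPlanarGeometry.ConformalRectangle,
        (∃ δ₀ : ℝ, 0 < δ₀ ∧ (∃ s : Finset (ℤ × ℤ), P.carrier = interior (⋃ p ∈ s,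
          {z : ℂ | δ₀ * (p.1 : ℝ) ≤ z.re ∧ z.re ≤ δ₀ * ((p.1 : ℝ) + 1) ∧ δ₀ * (p.2 : ℝ) ≤ z.im ∧
            z.im ≤ δ₀ * ((p.2 : ℝ) + 1)})) ∧
          ∀ i, ∃ m n : ℤ, P.pt i = (δ₀ : ℂ) * ((m : ℂ) + (n : ℂ) * Complex.I)) ∧
        (∃ (ψ : Literature.Probability.RandomPlanarGeometry.ConformalEquiv
            UpperHalfPlane.upperHalfPlaneSet P.carrier) (y : Fin 4 → ℝ),
          P.IsUniformizing ψ y ∧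
            |Literature.Probability.RandomPlanarGeometry.crossRatio y -
              Literature.Probability.RandomPlanarGeometry.crossRatio x| ≤ ε) ∧
        ∀ᶠ δ : ℝ in nhdsWithin 0 (Set.Ioi 0),
          Literature.Probability.Percolation.bondDomainCrossingProb R δ ≤
            Literature.Probability.Percolation.bondDomainCrossingProb P δ + ε

/-! ### The registered stubs `stub_…` (the only `sorry`s of the file) -/

/-- **STUB 1 — lower polyomino sandwich with modulus control** (F-free; Bollobás–Riordan 2006
Ch. 7 Lemma 14 + (19), lower half, for bond-`ℤ²` in the G02 discretisation, with a LATTICE-POLYGON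
comparison domain carrying LATTICE marks).  For every conformal rectangle `R` with uniformizing
datum `(φ, x)` and every `ε > 0` there is a polyomino conformal rectangle `P` (the crux's class,
verbatim) with a uniformizing datum `(ψ, y)` such that `|crossRatio y - crossRatio x| ≤ ε` and,
eventually as `δ → 0⁺`, `bond P δ ≤ bond R δ + ε`.
Why plausible: provable now by re-running the `hlow` block of
`LatticePolygonApproximation.cardyFormulaZ2_of_cardyLatticePolygon` without `F`
(`stub_comparisonGeometry`, `exists_latticePolygon_close`, `discreteCrossing_subset_of_lower`,
Radó `tendsto_crossRatio_of_tendsto_mark` / `CollarTouchSandwich.stub_modulusContinuity`).  Size M.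
[cite: BollobasRiordan2006, Ch. 7 Lemma 14 p. 184, (19), Claim 19 p. 192]
[cite: PommerenkeBBCM1992, Thm. 2.11] -/
theorem stub_lowerPolyominoSandwich :
    ∀ (R : Literature.Probability.RandomPlanarGeometry.ConformalRectangle)
      (φ : Literature.Probability.RandomPlanarGeometry.ConformalEquiv
        UpperHalfPlane.upperHalfPlaneSet R.carrier)
      (x : Fin 4 → ℝ), R.IsUniformizing φ x → ∀ ε : ℝ, 0 < ε →
      ∃ P : Literature.Probability.RandomPlanarGeometry.ConformalRectangle,
        (∃ δ₀ : ℝ, 0 < δ₀ ∧ (∃ s : Finset (ℤ × ℤ), P.carrier = interior (⋃ p ∈ s,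
          {z : ℂ | δ₀ * (p.1 : ℝ) ≤ z.re ∧ z.re ≤ δ₀ * ((p.1 : ℝ) + 1) ∧ δ₀ * (p.2 : ℝ) ≤ z.im ∧
            z.im ≤ δ₀ * ((p.2 : ℝ) + 1)})) ∧
          ∀ i, ∃ m n : ℤ, P.pt i = (δ₀ : ℂ) * ((m : ℂ) + (n : ℂ) * Complex.I)) ∧
        (∃ (ψ : Literature.Probability.RandomPlanarGeometry.ConformalEquiv
            UpperHalfPlane.upperHalfPlaneSet P.carrier) (y : Fin 4 → ℝ),
          P.IsUniformizing ψ y ∧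
            |Literature.Probability.RandomPlanarGeometry.crossRatio y -
              Literature.Probability.RandomPlanarGeometry.crossRatio x| ≤ ε) ∧
        ∀ᶠ δ : ℝ in nhdsWithin 0 (Set.Ioi 0),
          Literature.Probability.Percolation.bondDomainCrossingProb P δ ≤
            Literature.Probability.Percolation.bondDomainCrossingProb R δ + ε := by
  sorry

/-- **STUB 2 — upper polyomino sandwich with modulus control** (F-free; the flip-free upper half:
Schramm–Smirnov 2011 Lemma 5.1-type perturbation `D⁺` of a square model in MIXED POSITION above
the quad, Bollobás–Riordan Ch. 7 p. 195 remark; NEW for bond-`ℤ²` with polyomino comparison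
domains).  For every conformal rectangle `R` with uniformizing datum `(φ, x)` and every `ε > 0`
there is a polyomino conformal rectangle `P` with a uniformizing datum `(ψ, y)` such that
`|crossRatio y - crossRatio x| ≤ ε` and, eventually as `δ → 0⁺`, `bond R δ ≤ bond P δ + ε`.
Why plausible: for the square-model presentation of `R` the tree PROVES the deterministic
inclusion of G02 crossing events into those of any quad uniformly close to the wider–shorter
perturbation `D⁺` with its marks (`exists_upper_sandwich`, `exists_forall_discreteCrossing_subset_of_mixed`);
a lattice-polygon approximant of `D⁺` with matched marks is such a quad
(`exists_latticePolygon_close` + re-marking / `exists_reparam`), and its modulus tends to that of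
`R` as `t, τ → 0` by Radó (`tendsto_crossRatio_of_tendstoUniformly`); the crossing events and the
cross-ratio do not depend on the presentation (`hasCrossingLimit_iff_map_unitSquareQuad`,
`crossRatio_eq_of_isUniformizing_holds`).  Size M–L; the hardest stub of the line.
[cite: SchrammSmirnov2011, Lemma 5.1 p. 21 and Lemma 6.1 p. 22]
[cite: BollobasRiordan2006, Ch. 7 Claims 19–20 p. 192, remark p. 195] -/
theorem stub_upperPolyominoSandwich :
    ∀ (R : Literature.Probability.RandomPlanarGeometry.ConformalRectangle)
      (φ : Literature.Probability.RandomPlanarGeometry.ConformalEquiv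
        UpperHalfPlane.upperHalfPlaneSet R.carrier)
      (x : Fin 4 → ℝ), R.IsUniformizing φ x → ∀ ε : ℝ, 0 < ε →
      ∃ P : Literature.Probability.RandomPlanarGeometry.ConformalRectangle,
        (∃ δ₀ : ℝ, 0 < δ₀ ∧ (∃ s : Finset (ℤ × ℤ), P.carrier = interior (⋃ p ∈ s,
          {z : ℂ | δ₀ * (p.1 : ℝ) ≤ z.re ∧ z.re ≤ δ₀ * ((p.1 : ℝ) + 1) ∧ δ₀ * (p.2 : ℝ) ≤ z.im ∧
            z.im ≤ δ₀ * ((p.2 : ℝ) + 1)})) ∧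
          ∀ i, ∃ m n : ℤ, P.pt i = (δ₀ : ℂ) * ((m : ℂ) + (n : ℂ) * Complex.I)) ∧
        (∃ (ψ : Literature.Probability.RandomPlanarGeometry.ConformalEquiv
            UpperHalfPlane.upperHalfPlaneSet P.carrier) (y : Fin 4 → ℝ),
          P.IsUniformizing ψ y ∧
            |Literature.Probability.RandomPlanarGeometry.crossRatio y -
              Literature.Probability.RandomPlanarGeometry.crossRatio x| ≤ ε) ∧
        ∀ᶠ δ : ℝ in nhdsWithin 0 (Set.Ioi 0),
          Literature.Probability.Percolation.bondDomainCrossingProb R δ ≤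
            Literature.Probability.Percolation.bondDomainCrossingProb P δ + ε := by
  sorry

/-! ### Name-keyed aliases of the two statements (the hypotheses of the composition) -/
namespace __Registered

/-- Alias of `LowerPolyominoSandwich` keyed by the registered stub name. -/
abbrev stub_lowerPolyominoSandwich : Prop := LowerPolyominoSandwich
/-- Alias of `UpperPolyominoSandwich` keyed by the registered stub name. -/
abbrev stub_upperPolyominoSandwich : Prop := UpperPolyominoSandwich

end __Registered

/-! ### The composition (kernel-checked, no `sorry`) -/

/-- **Assembly** (kernel-checked, no `sorry`): the two polyomino sandwiches imply the crux
`CardyTensorRG.PolyominoToJordan` for EVERY `F` continuous on `(0,1)`.  Given `R`, `(φ, x)` and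
`e > 0`: continuity of `F` at `η = crossRatio x ∈ (0,1)` gives `τ`; the stubs at
`ε = min (τ/2) (e/3)` give polyomino quads `P⁻, P⁺` with `|F(η_{P^∓}) - F(η)| < e/3`; the
hypothesis on polyomino quads gives `bond P^∓ δ → F(η_{P^∓})`; hence eventually
`F(η) - e < bond P⁻ δ - ε ≤ bond R δ ≤ bond P⁺ δ + ε < F(η) + e`. [folklore] -/
theorem PolyominoToJordan_of (hlow : __Registered.stub_lowerPolyominoSandwich)
    (hup : __Registered.stub_upperPolyominoSandwich) :
    Summit.CriticalPhenomena.CardyFormulaZ2.Theses.CardyTensorRG.PolyominoToJordan := by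
  intro F hF hpoly R φ x hux
  -- the modulus of `R` lies in `(0,1)`, where `F` is continuous
  have hη : crossRatio x ∈ Ioo (0 : ℝ) 1 :=
    ConformalRectangle.crossRatio_mem_Ioo_of_isUniformizing hux
  have hFat : ContinuousAt F (crossRatio x) := hF.continuousAt (Ioo_mem_nhds hη.1 hη.2)
  rw [Metric.tendsto_nhds]
  intro e he
  obtain ⟨τ, hτ, hτF⟩ := Metric.continuousAt_iff.1 hFat (e / 3) (by positivity)
  have hε : 0 < min (τ / 2) (e / 3) := lt_min (by positivity) (by positivity)
  have hε₁ : min (τ / 2) (e / 3) < τ := (min_le_left _ _).trans_lt (by linarith)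
  have hε₂ : min (τ / 2) (e / 3) ≤ e / 3 := min_le_right _ _
  -- LOWER: a polyomino quad crossed at most `ε` more often than `R`, modulus `ε`-close
  have hlo : ∀ᶠ δ : ℝ in 𝓝[>] 0, F (crossRatio x) - e < bondDomainCrossingProb R δ := by
    obtain ⟨P, hPpoly, ⟨ψ, y, hψ, hmod⟩, hcmp⟩ := hlow R φ x hux _ hε
    have hFy : dist (F (crossRatio y)) (F (crossRatio x)) < e / 3 :=
      hτF (by rw [Real.dist_eq]; exact hmod.trans_lt hε₁)
    rw [Real.dist_eq, abs_sub_lt_iff] at hFy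
    have hPlim : Tendsto (bondDomainCrossingProb P) (𝓝[>] 0) (𝓝 (F (crossRatio y))) :=
      hpoly P hPpoly ψ y hψ
    have hev : ∀ᶠ δ : ℝ in 𝓝[>] 0, F (crossRatio y) - e / 3 < bondDomainCrossingProb P δ :=
      hPlim.eventually (lt_mem_nhds (by linarith))
    filter_upwards [hev, hcmp] with δ h1 h2
    linarith [hFy.1, hFy.2]
  -- UPPER: a polyomino quad crossed at least as often as `R` up to `ε`, modulus `ε`-close
  have hhi : ∀ᶠ δ : ℝ in 𝓝[>] 0, bondDomainCrossingProb R δ < F (crossRatio x) + e := by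
    obtain ⟨P, hPpoly, ⟨ψ, y, hψ, hmod⟩, hcmp⟩ := hup R φ x hux _ hε
    have hFy : dist (F (crossRatio y)) (F (crossRatio x)) < e / 3 :=
      hτF (by rw [Real.dist_eq]; exact hmod.trans_lt hε₁)
    rw [Real.dist_eq, abs_sub_lt_iff] at hFy
    have hPlim : Tendsto (bondDomainCrossingProb P) (𝓝[>] 0) (𝓝 (F (crossRatio y))) :=
      hpoly P hPpoly ψ y hψ
    have hev : ∀ᶠ δ : ℝ in 𝓝[>] 0, bondDomainCrossingProb P δ < F (crossRatio y) + e / 3 :=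
      hPlim.eventually (gt_mem_nhds (by linarith))
    filter_upwards [hev, hcmp] with δ h1 h2
    linarith [hFy.1, hFy.2]
  filter_upwards [hlo, hhi] with δ h1 h2
  rw [Real.dist_eq, abs_sub_lt_iff]
  constructor <;> linarith

/-- The composition applied to the two registered stubs LITERALLY (checks that the stub
statements and the hypotheses of `PolyominoToJordan_of` agree; its axiom closure contains
`sorryAx` exactly through the two stubs — it is NOT a proof of the item). [folklore] -/
theorem polyominoToJordan_of_stubs :
    Summit.CriticalPhenomena.CardyFormulaZ2.Theses.CardyTensorRG.PolyominoToJordan :=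
  PolyominoToJordan_of stub_lowerPolyominoSandwich stub_upperPolyominoSandwich

end Summit.CriticalPhenomena.CardyFormulaZ2.Cruxes.PolyominoToJordan.Birth

end
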